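import Summits.BirchSwinnertonDyer.BirchSwinnertonDyer.Theses.PrintCf2
import HarnessLib

/-!
# The glue item `PrintCf2.SplitBadTwoRankOneOfFactsGlue` (stmt-BirchSwinnertonDyer-27852, route PrintCf2 rev 26)

`SplitBadTwoUpperHalfOfFacts → SplitBadTwoLowerHalfOfFacts → SplitBadTwoRankOneOfFacts`: pure Miller Def. 1.1 bookkeeping — the
two halves `MissingUpperBoundAt W 2` / `MissingLowerBoundAt W 2` give `MissingPPartAt W 2` (`Typed.missingPPartAt_of_lower_of_upper`),
and GZK (first conjunct of the bundle 𝔅_split, `r_an ≤ 1`) turns that into `BSDp W 2` (`Typed.bsdp_of_missingPPartAt`). The converse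
(parent ⇒ both halves) is `halves_of_splitBadTwoRankOneOfFacts`: the split of crux stmt-BirchSwinnertonDyer-20368 into
stmt-BirchSwinnertonDyer-27850 / 27851 is a CONJUNCT split, `C ⟺ U ∧ D` modulo nothing but the bundle's own GZK finiteness of `Ш`.
Proof text = planner g14's evidence `GlueCandidate.lean` (planners never propose proofs), landed by width seat -w3 g2.
BSD is not proved by any of this; every statement here is relative to the named-fact bundle 𝔅_split.
-/

-- D-0017 layout: summit = sub-problem, so `Summit.BirchSwinnertonDyer.BirchSwinnertonDyer.…` is the mandated namespace.
set_option linter.dupNamespace false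

namespace Summit.BirchSwinnertonDyer.BirchSwinnertonDyer.Theorems.PrintCf2

open Summit.BirchSwinnertonDyer.BirchSwinnertonDyer.Theses.PrintCf2
  Literature.NumberTheory.EllipticCurves.Rank1Residual.Typed

/-- The glue item BY NAME: `SplitBadTwoUpperHalfOfFacts → SplitBadTwoLowerHalfOfFacts → SplitBadTwoRankOneOfFacts`. -/
theorem splitBadTwoRankOneOfFactsGlue : SplitBadTwoRankOneOfFactsGlue := by
  intro hU hD hB W _ _ hCM hr hsplit hng
  exact bsdp_of_missingPPartAt W 2 hB.1 (by rw [hr])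
    (missingPPartAt_of_lower_of_upper W 2 (hD hB W hCM hr hsplit hng) (hU hB W hCM hr hsplit hng))

/-- Converse bookkeeping: the parent crux returns both halves (GZK finiteness of `Ш` from the bundle + `missingPPartAt_of_bsdp`). -/
theorem halves_of_splitBadTwoRankOneOfFacts (h : SplitBadTwoRankOneOfFacts) :
    SplitBadTwoUpperHalfOfFacts ∧ SplitBadTwoLowerHalfOfFacts := by
  refine ⟨fun hB W _ _ hCM hr hsplit hng => ?_, fun hB W _ _ hCM hr hsplit hng => ?_⟩
  · obtain ⟨-, hfin⟩ := hB.1 W (by rw [hr])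
    haveI : Finite W.sha := hfin
    exact (lower_and_upper_of_missingPPartAt W 2 (missingPPartAt_of_bsdp W 2 (h hB W hCM hr hsplit hng))).2
  · obtain ⟨-, hfin⟩ := hB.1 W (by rw [hr])
    haveI : Finite W.sha := hfin
    exact (lower_and_upper_of_missingPPartAt W 2 (missingPPartAt_of_bsdp W 2 (h hB W hCM hr hsplit hng))).1

end Summit.BirchSwinnertonDyer.BirchSwinnertonDyer.Theorems.PrintCf2
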